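import Summits.NavierStokesRegularity.NavierStokesRegularity.Theorems.QuarterLogPincerCubeBridgeTools
import Summits.NavierStokesRegularity.NavierStokesRegularity.Theorems.TypeICertificateLadderTargetStrainCubeRung
import Summits.NavierStokesRegularity.NavierStokesRegularity.Theses.QuarterLogPincer
import HarnessLib

/-!
# `QuarterLogPincer.CubeBridge` (item stmt-NavierStokesRegularity-24078): a Type-I quantitative ESS
# bound with `log F_M(A) = o(A³)` forces the super-logarithmic `L³` CUBE at every Type-I blow-up

**Statement (the route decl, verbatim).** `CubeBridge := TypeIQuantSubcubicExp → SuperlogCubeRate`: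
if, for every `M`, Tao's quantitative velocity bound in Tao's class (`ν = 1`, all `H^k` norms of the
slices bounded on `[0,T]`) holds in the VIRTUAL TYPE-I sub-class `|u(t,x)| ≤ M (T+τ−t)^{-1/2}`
(`τ > 0`) with a size function `F = F_M` that is SUB-CUBIC-EXPONENTIAL (`F(A) ≤ e^{εA³}` for
`A ≥ A₀(ε)`, every `ε > 0`; `‖u(t)‖₃ ≤ A` on `[0,T]`, `A ≥ 2` ⇒ `|u(t,x)| ≤ F(A) t^{-1/2}`), then
every classical Leray–Hopf solution from a rapidly decaying datum with NO smooth extension past `T`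
and the velocity Type-I rate (`IsTypeIBlowup u T`) beats every envelope `C₁ + C₂ log(T/(T−t))`
in the `L³` CUBE `‖u(t)‖₃³` at some `t < T`.

PROOF (the route's two-layer plan, child `CubeBridge`; template = the landed
`Theorems.QuantBridge.quantBridge_proof`, with `A` replaced by the cube and the NEW virtual Type-I
input; tools in `QuarterLogPincerCubeBridgeTools.lean`). Suppose `‖u(t)‖₃³ ≤ C₁ + C₂ log(T/(T−t))`
on `[0,T)`.
* `CubeBridge.typeI_envelope` (tools): ONE constant `M_u` with `|u(t,x)| ≤ M_u (T−t)^{-1/2}` on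
  all of `[0,T)` (eventual Type-I rate + Tao-class sup bound on the early slab).
* `CubeBridge.norm_le_of_typeI_velocity_bound` (tools): the viscosity rescaling transports the
  clause to viscosity `ν` on `[0,t]`, the Type-I constant becoming `M = M_u/√ν` UNIFORMLY in `t`
  (`τ = T − t`), so `F = F_M` is chosen once.
* `eventually_rate_le`: on `[0,t]` the cube history is `≤ Y := |C₁| + |C₂| log(T/(T−t))`, so with
  `A := S^{1/3}`, `S := 8 + |A₀|³ + ν⁻³Y` (`A ≥ 2`, `A ≥ A₀`, `‖u(s)‖₃ ≤ νA` as `Y ≤ (νA)³`) and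
  `ε := ν³/(4(|C₂|+1))` (`εν⁻³|C₂| ≤ 1/4`): `F(A) ≤ e^{εA³} = e^{εS} ≤ e^{E₀}(T/(T−t))^{1/4}`, whence
  `√(T−t)|u(t,x)| ≤ M₀ (T−t)^{1/4} → 0`, in particular `≤ √ν` near `T`.
* `cubeBridge_proof`: the in-tree Leray-rate rung
  `DepletionLadder.StrainCube.hasSmoothExtensionPast_of_rate_lt` (constant `1`, `(√3+√6)/9 < 1`)
  produces a smooth extension past `T` — contradiction.

HONEST FRAMING: a conditional bridge between two OPEN statements of route `QuarterLogPincer`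
(`TypeIQuantSubcubicExp`, stmt-24077, the `o_M(A³)` improvement of Barker–Prange 2021 Prop. 2 —
ON the DSS wall; `SuperlogCubeRate`, stmt-23934); nothing here asserts either, and Navier–Stokes
regularity is NOT proved or claimed. References: Tao, arXiv:1908.04958 Thm 1.2 (shape of the
velocity clause); Tao 2013 footnote 3 (viscosity rescaling); Leray 1934 (the rate); Barker–Prange,
CMP 385 (2021) (the Type-I quantitative class). [folklore]
-/

noncomputable section

open Set Filter Topology MeasureTheory Function
open scoped ENNReal NNReal
open Literature.Analysis Literature.Analysis.FluidPDE

namespace Summit.NavierStokesRegularity.NavierStokesRegularity.Theorems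

-- the problem directory repeats the summit name (`NavierStokesRegularity/NavierStokesRegularity`)
set_option linter.dupNamespace false

namespace CubeBridge

/-! ### Step 3: the dimensionless rate tends to zero -/

/-- **Log-bounded `L³` CUBE history + virtual Type-I envelope + sub-cubic-exponential Type-I Tao
function ⇒ the dimensionless rate tends to zero.** Under the virtual-Type-I velocity clause (constant
`M`) with `F(A) ≤ e^{εA³}` for `A ≥ A₀(ε)`, a classical Leray–Hopf solution on `[0,T)` from a rapidly
decaying datum with `|u(t,x)| ≤ √ν·M·(T−t)^{-1/2}` and `‖u(t)‖₃³ ≤ C₁ + C₂ log(T/(T−t))` on `[0,T)`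
satisfies, for `t < T` close to `T`, `√(T−t)‖u(t,x)‖ ≤ √ν` for all `x` (indeed
`≤ M₀ (T−t)^{1/4}`): with `A = S^{1/3}`, `S = 8 + |A₀|³ + ν⁻³(|C₁| + |C₂| log(T/(T−t)))` and
`ε = ν³/(4(|C₂|+1))`, `F(A) ≤ e^{εS} ≤ e^{E₀}(T/(T−t))^{1/4}`. [folklore] -/
theorem eventually_rate_le {F : ℝ → ℝ} {M : ℝ}
    (hsub : ∀ ε : ℝ, 0 < ε → ∃ A₀ : ℝ, ∀ A : ℝ, A₀ ≤ A → F A ≤ Real.exp (ε * A ^ 3))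
    (hTao : ∀ (T τ A : ℝ) (u : ℝ → EuclideanSpace ℝ (Fin 3) → EuclideanSpace ℝ (Fin 3))
      (p : ℝ → EuclideanSpace ℝ (Fin 3) → ℝ),
      (IsClassicalNSSolutionOn (Icc 0 T) 1 0 u p ∧
        ∀ n : ℕ, ∃ C : ℝ≥0, ∀ t ∈ Icc 0 T, eLpNorm (iteratedFDeriv ℝ n (u t)) 2 volume ≤ C) →
      0 < τ →
      (∀ t ∈ Icc 0 T, ∀ x : EuclideanSpace ℝ (Fin 3), ‖u t x‖ ≤ M * (T + τ - t) ^ (-(1 / 2 : ℝ))) →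
      (∀ t ∈ Icc 0 T, eLpNorm (u t) 3 volume ≤ ENNReal.ofReal A) → 2 ≤ A →
      ∀ t ∈ Ioc 0 T, ∀ x : EuclideanSpace ℝ (Fin 3), ‖u t x‖ ≤ F A * t ^ (-(1 / 2 : ℝ)))
    {ν T : ℝ} (hν : 0 < ν) (hT : 0 < T)
    {u : ℝ → EuclideanSpace ℝ (Fin 3) → EuclideanSpace ℝ (Fin 3)}
    {p : ℝ → EuclideanSpace ℝ (Fin 3) → ℝ} (hcl : IsClassicalNSSolutionOn (Ico 0 T) ν 0 u p)
    (hLH : IsLerayHopfOn T ν 0 (u 0) u) (hdec : HasRapidSpatialDecay (u 0))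
    (hMu : ∀ t ∈ Ico 0 T, ∀ x : EuclideanSpace ℝ (Fin 3),
      ‖u t x‖ ≤ Real.sqrt ν * M * (T - t) ^ (-(1 / 2 : ℝ)))
    {C₁ C₂ : ℝ}
    (hlog : ∀ t ∈ Ico 0 T, eLpNorm (u t) 3 volume ^ (3 : ℕ) ≤
      ENNReal.ofReal (C₁ + C₂ * Real.log (T / (T - t)))) :
    ∀ᶠ t in 𝓝[<] T, ∀ x, Real.sqrt (T - t) * ‖u t x‖ ≤ 1 * Real.sqrt ν := by
  -- ### constants
  have hν' : 0 ≤ ν⁻¹ := inv_nonneg.2 hν.le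
  have hν0 : ν ≠ 0 := hν.ne'
  set ε : ℝ := ν ^ 3 / (4 * (|C₂| + 1)) with hε
  have hC₂1 : 0 < |C₂| + 1 := by positivity
  have hε0 : 0 < ε := by positivity
  have hεC : ε * ν⁻¹ ^ 3 * |C₂| ≤ 1 / 4 := by
    have h1 : ε * ν⁻¹ ^ 3 * |C₂| = |C₂| / (4 * (|C₂| + 1)) := by
      rw [hε]
      field_simp
    rw [h1, div_le_iff₀ (by positivity)]
    nlinarith [abs_nonneg C₂]
  obtain ⟨A₀, hA₀⟩ := hsub ε hε0
  set E₀ : ℝ := ε * (8 + |A₀| ^ 3 + ν⁻¹ ^ 3 * |C₁|) with hE₀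
  set M₀ : ℝ := ν * Real.exp E₀ * (ν * (T / 2)) ^ (-(1 / 2 : ℝ)) * T ^ (1 / 4 : ℝ) with hM₀
  have hM₀0 : 0 < M₀ := by positivity
  set δ : ℝ := (Real.sqrt ν / M₀) ^ (4 : ℕ) with hδ
  have hδ0 : 0 < δ := by positivity
  set η : ℝ := min (T / 2) δ with hη
  have hη0 : 0 < η := lt_min (by positivity) hδ0
  have hηT : η ≤ T / 2 := min_le_left _ _
  have hηδ : η ≤ δ := min_le_right _ _
  -- ### the bound on `(T - η, T)`
  filter_upwards [Ioo_mem_nhdsLT (show T - η < T by linarith)] with t ht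
  intro x
  rw [one_mul]
  have ht0 : 0 < t := by linarith [ht.1]
  have htT2 : T / 2 ≤ t := by linarith [ht.1]
  have htT : t < T := ht.2
  have hTt : 0 < T - t := sub_pos.2 htT
  have hTtδ : T - t ≤ δ := by linarith [ht.1]
  set L : ℝ := Real.log (T / (T - t)) with hL
  have hL0 : 0 ≤ L := Real.log_nonneg ((one_le_div hTt).2 (by linarith))
  -- Tao-class cover of `[0, t]`
  obtain ⟨q, hclq, hHk, -, -⟩ := RungReynoldsOne.stub_taoCover hν hT hcl hLH hdec (T' := t) ⟨ht0, htT⟩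
  -- the size parameter `A = S^{1/3}`
  set Y : ℝ := |C₁| + |C₂| * L with hY
  have hY0 : 0 ≤ Y := by positivity
  set S : ℝ := 8 + |A₀| ^ 3 + ν⁻¹ ^ 3 * Y with hS
  have hS0 : 0 ≤ S := by positivity
  set A : ℝ := S ^ (1 / 3 : ℝ) with hA
  have hA0 : 0 ≤ A := Real.rpow_nonneg hS0 _
  have hA3 : A ^ 3 = S := by
    rw [hA, ← Real.rpow_natCast, ← Real.rpow_mul hS0]
    norm_num
  have hA2 : 2 ≤ A := by
    refine le_of_pow_le_pow_left₀ (n := 3) (by norm_num) hA0 ?_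
    rw [hA3, hS]
    have : 0 ≤ |A₀| ^ 3 + ν⁻¹ ^ 3 * Y := by positivity
    linarith
  have hA₀A : A₀ ≤ A := by
    refine (le_abs_self A₀).trans (le_of_pow_le_pow_left₀ (n := 3) (by norm_num) hA0 ?_)
    rw [hA3, hS]
    have : 0 ≤ ν⁻¹ ^ 3 * Y := by positivity
    linarith
  have hνA : 0 ≤ ν * A := by positivity
  -- the `L³` bound on `[0, t]`: `‖u(τ)‖₃ ≤ νA` since `‖u(τ)‖₃³ ≤ Y ≤ (νA)³`
  have hYνA : Y ≤ (ν * A) ^ 3 := by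
    rw [mul_pow, hA3, hS]
    have h8 : 0 ≤ ν ^ 3 * (8 + |A₀| ^ 3) := by positivity
    have hid : ν ^ 3 * (ν⁻¹ ^ 3 * Y) = Y := by field_simp
    nlinarith
  have hNb : ∀ τ ∈ Icc 0 t, eLpNorm (u τ) 3 volume ≤ ENNReal.ofReal (ν * A) := by
    intro τ hτ
    have hTτ : 0 < T - τ := by linarith [hτ.2]
    have hLτ0 : 0 ≤ Real.log (T / (T - τ)) :=
      Real.log_nonneg ((one_le_div hTτ).2 (by linarith [hτ.1]))
    have hLτ : Real.log (T / (T - τ)) ≤ L :=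
      Real.log_le_log (div_pos hT hTτ) (div_le_div_of_nonneg_left hT.le hTt (by linarith [hτ.2]))
    have hcube : eLpNorm (u τ) 3 volume ^ (3 : ℕ) ≤ ENNReal.ofReal (ν * A) ^ (3 : ℕ) := by
      refine (hlog τ ⟨hτ.1, hτ.2.trans_lt htT⟩).trans ?_
      rw [← ENNReal.ofReal_pow hνA]
      refine ENNReal.ofReal_le_ofReal (le_trans ?_ hYνA)
      calc C₁ + C₂ * Real.log (T / (T - τ))
          ≤ |C₁| + |C₂| * Real.log (T / (T - τ)) := by
            refine add_le_add (le_abs_self _) ?_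
            calc C₂ * Real.log (T / (T - τ)) ≤ |C₂ * Real.log (T / (T - τ))| := le_abs_self _
              _ = |C₂| * Real.log (T / (T - τ)) := by rw [abs_mul, abs_of_nonneg hLτ0]
        _ ≤ |C₁| + |C₂| * L := by gcongr
    exact (ENNReal.pow_le_pow_left_iff (by norm_num)).1 hcube
  -- the virtual Type-I bound on `[0, t]` with `τ = T - t`
  have hMslab : ∀ s ∈ Icc 0 t, ∀ x : EuclideanSpace ℝ (Fin 3),
      ‖u s x‖ ≤ Real.sqrt ν * M * (t + (T - t) - s) ^ (-(1 / 2 : ℝ)) := by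
    intro s hs y
    rw [add_sub_cancel]
    exact hMu s ⟨hs.1, hs.2.trans_lt htT⟩ y
  -- the velocity clause at viscosity `ν`, read at time `t`
  have hvel := norm_le_of_typeI_velocity_bound hTao hν ht0 hTt hA2 hclq hHk hMslab hNb
    t ⟨ht0, le_rfl⟩ x
  have hFA : F A ≤ Real.exp (ε * A ^ 3) := hA₀ A hA₀A
  have hεA : ε * A ^ 3 ≤ E₀ + L / 4 := by
    calc ε * A ^ 3 = E₀ + (ε * ν⁻¹ ^ 3 * |C₂|) * L := by rw [hA3, hS, hY, hE₀]; ring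
      _ ≤ E₀ + (1 / 4) * L := by gcongr
      _ = E₀ + L / 4 := by ring
  have hexpA : Real.exp (ε * A ^ 3) ≤ Real.exp E₀ * (T / (T - t)) ^ (1 / 4 : ℝ) := by
    calc Real.exp (ε * A ^ 3) ≤ Real.exp (E₀ + L / 4) := Real.exp_le_exp.2 hεA
      _ = Real.exp E₀ * Real.exp (L / 4) := Real.exp_add _ _
      _ = Real.exp E₀ * (T / (T - t)) ^ (1 / 4 : ℝ) := by
          rw [Real.rpow_def_of_pos (div_pos hT hTt), hL]
          congr 2
          ring
  have hFle : F A ≤ Real.exp E₀ * (T / (T - t)) ^ (1 / 4 : ℝ) := hFA.trans hexpA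
  -- the pointwise bound at time `t`
  have hrt : 0 ≤ (ν * t) ^ (-(1 / 2 : ℝ)) := Real.rpow_nonneg (by positivity) _
  have hrt' : (ν * t) ^ (-(1 / 2 : ℝ)) ≤ (ν * (T / 2)) ^ (-(1 / 2 : ℝ)) :=
    Real.rpow_le_rpow_of_nonpos (by positivity) (by nlinarith) (by norm_num)
  have hu : ‖u t x‖ ≤ ν * (Real.exp E₀ * (T / (T - t)) ^ (1 / 4 : ℝ)) *
      (ν * (T / 2)) ^ (-(1 / 2 : ℝ)) := by
    calc ‖u t x‖ ≤ ν * F A * (ν * t) ^ (-(1 / 2 : ℝ)) := hvel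
      _ ≤ ν * (Real.exp E₀ * (T / (T - t)) ^ (1 / 4 : ℝ)) * (ν * t) ^ (-(1 / 2 : ℝ)) := by
          gcongr
      _ ≤ ν * (Real.exp E₀ * (T / (T - t)) ^ (1 / 4 : ℝ)) * (ν * (T / 2)) ^ (-(1 / 2 : ℝ)) := by
          gcongr
  -- `√(T−t) (T/(T−t))^{1/4} = T^{1/4} (T−t)^{1/4}`
  have hsplit : Real.sqrt (T - t) * (T / (T - t)) ^ (1 / 4 : ℝ) =
      T ^ (1 / 4 : ℝ) * (T - t) ^ (1 / 4 : ℝ) := by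
    have h14 : 0 < (T - t) ^ (1 / 4 : ℝ) := Real.rpow_pos_of_pos hTt _
    rw [Real.div_rpow hT.le hTt.le, Real.sqrt_eq_rpow,
      show (T - t) ^ (1 / 2 : ℝ) = (T - t) ^ (1 / 4 : ℝ) * (T - t) ^ (1 / 4 : ℝ) by
        rw [← Real.rpow_add hTt]; norm_num]
    field_simp
  -- `(T−t)^{1/4} ≤ √ν / M₀`
  have hquart : (T - t) ^ (1 / 4 : ℝ) ≤ Real.sqrt ν / M₀ := by
    calc (T - t) ^ (1 / 4 : ℝ) ≤ δ ^ (1 / 4 : ℝ) := Real.rpow_le_rpow hTt.le hTtδ (by norm_num)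
      _ = Real.sqrt ν / M₀ := by
          rw [hδ, ← Real.rpow_natCast, ← Real.rpow_mul (by positivity)]
          norm_num
  -- assemble
  calc Real.sqrt (T - t) * ‖u t x‖
      ≤ Real.sqrt (T - t) * (ν * (Real.exp E₀ * (T / (T - t)) ^ (1 / 4 : ℝ)) *
          (ν * (T / 2)) ^ (-(1 / 2 : ℝ))) :=
        mul_le_mul_of_nonneg_left hu (Real.sqrt_nonneg _)
    _ = M₀ * (T - t) ^ (1 / 4 : ℝ) := by
        have : Real.sqrt (T - t) * (ν * (Real.exp E₀ * (T / (T - t)) ^ (1 / 4 : ℝ)) *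
            (ν * (T / 2)) ^ (-(1 / 2 : ℝ))) =
            ν * Real.exp E₀ * (ν * (T / 2)) ^ (-(1 / 2 : ℝ)) *
              (Real.sqrt (T - t) * (T / (T - t)) ^ (1 / 4 : ℝ)) := by ring
        rw [this, hsplit, hM₀]
        ring
    _ ≤ M₀ * (Real.sqrt ν / M₀) := mul_le_mul_of_nonneg_left hquart hM₀0.le
    _ = Real.sqrt ν := by field_simp

/-! ### Step 4: the item -/

/-- **Item stmt-NavierStokesRegularity-24078** (`QuarterLogPincer.CubeBridge`):
`TypeIQuantSubcubicExp → SuperlogCubeRate`. By contradiction: the Type-I envelope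
(`typeI_envelope`, constant `M_u`) selects the Tao function `F = F_M` with `M = M_u/√ν`; a
log-bounded `L³` cube history and the sub-cubic-exponential virtual-Type-I velocity clause make the
dimensionless rate `√(T−t)‖u(t)‖_∞` eventually `≤ √ν` (`eventually_rate_le`), and the Leray-rate
rung `hasSmoothExtensionPast_of_rate_lt` (constant `1`, `(√3+√6)/9 < 1`) extends the solution past
`T`, against `¬ HasSmoothExtensionPast`. NOT a regularity claim: both sides of the bridge are open
statements of the route. [folklore] -/
theorem cubeBridge_proof :
    Summit.NavierStokesRegularity.NavierStokesRegularity.Theses.QuarterLogPincer.CubeBridge := by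
  unfold Summit.NavierStokesRegularity.NavierStokesRegularity.Theses.QuarterLogPincer.CubeBridge
    Summit.NavierStokesRegularity.NavierStokesRegularity.Theses.QuarterLogPincer.TypeIQuantSubcubicExp
    Summit.NavierStokesRegularity.NavierStokesRegularity.Theses.QuarterLogPincer.SuperlogCubeRate
  intro hQ ν T hν hT u p hcl hLH hdec hnext hI C₁ C₂
  by_contra hcon
  have hcon' : ∀ t ∈ Ico 0 T, eLpNorm (u t) 3 volume ^ (3 : ℕ) ≤
      ENNReal.ofReal (C₁ + C₂ * Real.log (T / (T - t))) :=
    fun t ht => not_lt.1 fun hlt => hcon ⟨t, ht, hlt⟩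
  -- the global Type-I envelope and the Tao function `F = F_M`, `M = M_u / √ν`
  obtain ⟨Mu, -, hMu⟩ := typeI_envelope hν hT hcl hLH hdec hI
  obtain ⟨F, hsub, hTao⟩ := hQ (Mu / Real.sqrt ν)
  have hsν : Real.sqrt ν ≠ 0 := (Real.sqrt_pos.2 hν).ne'
  have hMu' : ∀ t ∈ Ico 0 T, ∀ x : EuclideanSpace ℝ (Fin 3),
      ‖u t x‖ ≤ Real.sqrt ν * (Mu / Real.sqrt ν) * (T - t) ^ (-(1 / 2 : ℝ)) := by
    intro t ht x
    rw [mul_div_cancel₀ Mu hsν]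
    exact hMu t ht x
  have hrate := eventually_rate_le hsub hTao hν hT hcl hLH hdec hMu' hcon'
  have hκ : (Real.sqrt 3 + Real.sqrt 6) / 9 * 1 < 1 := by
    rw [mul_one]
    exact DepletionLadder.StrainCube.depletion_constant_lt_half.trans (by norm_num)
  exact hnext (DepletionLadder.StrainCube.hasSmoothExtensionPast_of_rate_lt hν hT one_pos hκ hcl
    hLH hdec hrate)

end CubeBridge

end Summit.NavierStokesRegularity.NavierStokesRegularity.Theorems

end
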